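import Summits.CriticalPhenomena.PercolationContinuityZ3.Theorems.SahiMasterFamilyPhiCylinder

/-!
# `F(k+1)` with ONE FREE INDEX: if the restriction of `β` to the sets avoiding one index is quotient-positive (e.g. a finite product
# of min-closed set functions) then `Φ_{k+1}(β) ≥ 0` — no constraint at all on the values at the sets containing that index (beyond
# `β ≤ 1`, `β_univ = 1`), every order

Unit `prim-masterthm-p4` (gen 14; crux anchor stmt-CriticalPhenomena-4575, helper work; memo
`run/shared/lean/prim/prim-masterthm/prim-masterthm-p4/P4-GEN14-REPORT.md` §4).  Companion of `…PhiCylinder` (quotient-positive monoid,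
products of min-closed functions, cylinder systems) and `…PrincipalCapStep` (gen 13's abstract step: only the honest sub-functionals AVOIDING
the last index are needed).

**THEOREM** `phiSet_nonneg_of_qp_off_last` (every order): let `β : Finset (Fin (k+1)) → ℝ` with `β ≤ 1` and `β univ = 1`; if
`β^♭ := (S : Finset (Fin k)) ↦ β(castSucc(S))` is QUOTIENT-POSITIVE (all `Φ_L(Q ↦ β^♭(⋃_{m∈Q} B_m)) ≥ 0` for pairwise disjoint blocks), then
`Φ_{k+1}(β) ≥ 0`.  By `PhiCylinder`, `β^♭` is quotient-positive as soon as it is a finite product of min-closed `[0,1]`-valued functions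
(`phiSet_nonneg_of_prod_minClosed_off_last`), e.g. a cylinder system, a chain of union-closed families, a vertex `1_𝒰`.  Any index can play
the role of the last one (`phiSet_nonneg_of_qp_off`, relabelling by `PhiCert.phiSet_actV`).  The values `β_S`, `last ∈ S ≠ univ`, are
ARBITRARY in `(-∞, 1]` — not even supermultiplicativity is needed there.  CENSUS (memo §4, code-g14/xk_census2.py): among random feasible
points of `X_k` (box, top, supermultiplicativity; fibered sampler) the hypothesis "quotient-positive off some index" holds for 399/400 (k=3),
279/300 (k=4), 61/80 (k=5), against 265/400, 133/300, 14/80 for "quotient-positive everywhere".  HONEST FRAMING: an explicit region of validity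
of `F(k+1)` for every `k`; `PhiNonneg k` (k ≥ 8), Sahi's `C_k`, Kahn's Conjecture 5 and the master theorem remain OPEN.  Axioms standard. [this work]
-/

noncomputable section

open scoped Classical

namespace Summit.CriticalPhenomena.PercolationContinuityZ3.Theorems

namespace PhiFreeIndex

open Finset Function
open Literature.Combinatorics.Sahi2008
open PrincipalCapBeta (phiSet)

variable {k : ℕ}

/-- An embedding into `Fin (k+1)` missing the last index factors through `Fin.castSucc`. [folklore] -/
theorem exists_factor_castSucc {m : ℕ} (e : Fin m ↪ Fin (k + 1)) (he : ∀ j, e j ≠ Fin.last k) :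
    ∃ e' : Fin m ↪ Fin k, ∀ j, e j = Fin.castSucc (e' j) := by
  refine ⟨⟨fun j => (e j).castPred (he j), fun j j' h => e.injective ?_⟩, fun j => ?_⟩
  · have := congrArg Fin.castSucc h
    simpa only [Fin.castSucc_castPred] using this
  · simp only [Embedding.coeFn_mk, Fin.castSucc_castPred]

/-- **One free index (the last).**  `β ≤ 1`, `β univ = 1` and the restriction of `β` off the last index quotient-positive ⇒ `Φ_{k+1}(β) ≥ 0`.
[this work] -/
theorem phiSet_nonneg_of_qp_off_last (β : Finset (Fin (k + 1)) → ℝ) (h1 : ∀ B, β B ≤ 1) (huniv : β univ = 1)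
    (hq : ∀ (L : ℕ) (B : Fin L → Finset (Fin k)), (∀ i j, i ≠ j → Disjoint (B i) (B j)) →
      0 ≤ phiSet L (fun Q => β ((Q.biUnion B).map Fin.castSuccEmb))) :
    0 ≤ phiSet (k + 1) β := by
  refine PrincipalCapStep.phiSet_nonneg_of_subfamilies β h1 huniv fun m e he => ?_
  obtain ⟨e', he'⟩ := exists_factor_castSucc e he
  have hfun : (fun S : Finset (Fin (m + 1)) => β (S.map e)) =
      fun S => (fun T : Finset (Fin k) => β (T.map Fin.castSuccEmb)) (S.map e') := by
    funext S
    show β (S.map e) = β ((S.map e').map Fin.castSuccEmb)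
    rw [Finset.map_map]
    congr 1
    ext x
    simp only [mem_map, Embedding.trans_apply]
    constructor
    · rintro ⟨j, hj, rfl⟩; exact ⟨j, hj, (he' j).symm⟩
    · rintro ⟨j, hj, rfl⟩; exact ⟨j, hj, he' j⟩
  rw [hfun]
  exact PhiCylinder.phiSet_map_nonneg_of_qp (fun T : Finset (Fin k) => β (T.map Fin.castSuccEmb)) hq (m + 1) e'

/-- **One free index (any index `i`)**, by relabelling. [this work] -/
theorem phiSet_nonneg_of_qp_off (β : Finset (Fin (k + 1)) → ℝ) (h1 : ∀ B, β B ≤ 1) (huniv : β univ = 1) (i : Fin (k + 1))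
    (hq : ∀ (L : ℕ) (B : Fin L → Finset (Fin k)), (∀ a b, a ≠ b → Disjoint (B a) (B b)) →
      0 ≤ phiSet L (fun Q => β (((Q.biUnion B).map Fin.castSuccEmb).map (Equiv.swap i (Fin.last k)).toEmbedding))) :
    0 ≤ phiSet (k + 1) β := by
  rw [← PhiCert.phiSet_actV (Equiv.swap i (Fin.last k))]
  refine phiSet_nonneg_of_qp_off_last _ (fun B => h1 _) (by rw [PhiCert.actV_univ]; exact huniv) fun L B hB => ?_
  exact hq L B hB

/-- **`F(k+1)` when the restriction off the last index is a finite product of min-closed functions** (e.g. a cylinder system, a chain,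
a vertex): then `Φ_{k+1}(β) ≥ 0` whatever the values `β_S ≤ 1` on the sets containing the last index (`β univ = 1`). [this work] -/
theorem phiSet_nonneg_of_prod_minClosed_off_last {X : Type*} (s : Finset X) (γ : X → Finset (Fin k) → ℝ)
    (h0 : ∀ x ∈ s, ∀ B, 0 ≤ γ x B) (h1γ : ∀ x ∈ s, ∀ B, γ x B ≤ 1) (hmin : ∀ x ∈ s, ∀ S T, min (γ x S) (γ x T) ≤ γ x (S ∪ T))
    (β : Finset (Fin (k + 1)) → ℝ) (h1 : ∀ B, β B ≤ 1) (huniv : β univ = 1)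
    (hrestr : ∀ T : Finset (Fin k), β (T.map Fin.castSuccEmb) = ∏ x ∈ s, γ x T) :
    0 ≤ phiSet (k + 1) β := by
  refine phiSet_nonneg_of_qp_off_last β h1 huniv fun L B hB => ?_
  have hfun : (fun Q : Finset (Fin L) => β ((Q.biUnion B).map Fin.castSuccEmb)) = fun Q => ∏ x ∈ s, γ x (Q.biUnion B) :=
    funext fun Q => hrestr _
  rw [hfun]
  exact PhiCylinder.qp_finset_prod γ s (fun x hx => PhiCylinder.qp_of_minClosed (γ x) (h0 x hx) (h1γ x hx) (hmin x hx)) L B hB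

/-- Special case: the restriction off the last index is itself min-closed (one factor). [this work] -/
theorem phiSet_nonneg_of_minClosed_off_last (β : Finset (Fin (k + 1)) → ℝ) (h1 : ∀ B, β B ≤ 1) (huniv : β univ = 1)
    (h0 : ∀ T : Finset (Fin k), 0 ≤ β (T.map Fin.castSuccEmb))
    (hmin : ∀ S T : Finset (Fin k), min (β (S.map Fin.castSuccEmb)) (β (T.map Fin.castSuccEmb)) ≤ β ((S ∪ T).map Fin.castSuccEmb)) :
    0 ≤ phiSet (k + 1) β :=
  phiSet_nonneg_of_qp_off_last β h1 huniv
    (PhiCylinder.qp_of_minClosed (fun T : Finset (Fin k) => β (T.map Fin.castSuccEmb)) h0 (fun _ => h1 _) hmin)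

end PhiFreeIndex

end Summit.CriticalPhenomena.PercolationContinuityZ3.Theorems
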